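/-
Copyright: the b2b-balaban T⁴-continuum CRUX team, row NE7b leaf lineage `t4-ne7b-formalise-leaf-04` (gen 152). Project licence.
-/
import Mathlib.Analysis.Calculus.InverseFunctionTheorem.ApproximatesLinearOn
import Mathlib.Analysis.Calculus.MeanValue
import Mathlib.Analysis.Normed.Operator.Prod

/-!
# THE HARD STEP'S BACKGROUND FIELD ON A CHART OF EXPLICIT RADIUS, LIPSCHITZ WITH AN OPERATOR-NORM CONSTANT:
# `Φ ≈ T` on `closedBall δ₀ r` with defect `c`, `‖T⁻¹ y‖ ≤ N‖y‖`, `c < N⁻¹` ⟹ every `y` within `(N⁻¹ − c) r` of `Φ δ₀` has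
# EXACTLY ONE preimage in the `r`-ball, the local inverse is `(N⁻¹ − c)⁻¹`-Lipschitz, and along a slice `Φ = (D, g)` the
# branch `σ` of `g = const` points (constrained critical points: `g = DV|_K`) is defined on `closedBall (Dδ₀) ((N⁻¹ − c) r)`,
# `(N⁻¹ − c)⁻¹`-Lipschitz, unique in the whole `r`-ball — the QUANTITATIVE twin of `…ConstrainedMinimiserRegular`'s `∀ᶠ`
# branch (row NE7b, node U5c; TRANSFER rows (ix)∕(xxiv): King CMP 102 (2.18) «the background field's Lipschitz constant is an
# operator norm», [B11] CMP 102 (59)–(62)∕(70)–(71) «contraction ∕ Neumann series with ‖(I + 𝔎R)⁻¹‖»; [folklore])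

Cell `pub-balaban`, sub-cell `t4`, spine estimate NE7b (`T4WeightBudget.RelWeightBound`; the cell's OWN estimate — NOT PRINTED
in [Bałaban 1983–89], NOT PROVED).  Crux-route work under `Spine/NE7b/` by leaf-04 (CRUX team (2), FREEZE (0) crux-prover clause).
NOTHING of Bałaban's is named, asserted, valued or discharged; no `T4Continuum/Support` leaf typed; no `def`; zero `sorry`.  Imports
Mathlib ONLY (`ApproximatesLinearOn`, the mean value inequality, the operator norm on products) — independent of the `Spine/NE7b`
olean frontier; in particular it does NOT import `…ConstrainedMinimiserRegular` (CMR), whose §1 it quantifies in CMR's own letters.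

WHY.  CMR ∕ CMRN ∕ CMRA (leaf-03) type the hard step's background field — the branch `σ` of constrained critical points through a
non-degenerate one — by Mathlib's inverse function theorems: `Cⁿ`, resp. analytic, with every conclusion `∀ᶠ` near the base point
and NO radius, NO constant.  idea-1's T-93 (2026-08-24) located what print puts in that place on the gauge road: NOT a convexity
modulus (this lineage's SBL `2aκ∕σ` is the scalar-side abstraction) but «implicit-function ∕ contraction on a gauge-fixed chart in
the small-field region» with CONSTANTS — [B11] (61) «exactly one fixed point … for ε₂ ≤ ⅛ε₃», (70) «uniquely solvable by a convergent
Neumann series», (71) `‖(I + 𝔎R)⁻¹‖`; and on the abelian side King's (2.18), where the background field is linear in the kept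
variable with an operator norm for Lipschitz constant.  A chart used along a multi-scale flow is worth exactly its radius and its
constant; this file supplies both, in Mathlib's `ApproximatesLinearOn` currency, for ANY map `Φ` on ANY complete `E`: no finite
dimension, no convexity, no `∀ᶠ`.  The inverse-norm letter is displayed POINTWISE (`‖T⁻¹ y‖ ≤ N‖y‖`) so that a consumer never has
to synthesise an operator norm on an exotic target.

WHAT IS PROVED ([folklore]; the quantitative inverse function theorem ∕ Banach's fixed point with a parameter, e.g. Dieudonné,
*Foundations of Modern Analysis* (10.1.1)–(10.2.1); Deimling, *Nonlinear Functional Analysis* Thm 15.1; proved here from Mathlib's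
`ApproximatesLinearOn.surjOn_closedBall_of_nonlinearRightInverse` ∕ `.injOn` ∕ `.antilipschitz` and
`Convex.norm_image_sub_le_of_norm_fderiv_le'`, nothing cited as a fact).  Standing letters: `E` complete and nontrivial, `Φ : E → G`,
`T : E ≃L[ℝ] G` with `‖T⁻¹ y‖ ≤ N‖y‖`, `ApproximatesLinearOn Φ T (closedBall δ₀ r) c` (`‖Φ x − Φ y − T(x − y)‖ ≤ c‖x − y‖`),
`c < N⁻¹`; RADIUS `ρ := (N⁻¹ − c)·r`, CONSTANT `(N⁻¹ − c)⁻¹`.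
* §0 `nnnorm_symm_pos`, `nnnorm_symm_le_of_bound`, `lt_inv_nnnorm_symm`, `inv_sub_le_inv_nnnorm_symm_sub` — the inverse-norm
  letter in Mathlib's form (`c < ‖T⁻¹‖⁻¹`; the `N`-ball sits inside Mathlib's `‖T⁻¹‖⁻¹`-ball).
* §1 THE CHART: **`norm_sub_le_mul_norm_apply_sub`** (`‖δ − δ′‖ ≤ (N⁻¹ − c)⁻¹‖Φ δ − Φ δ′‖` on the `r`-ball),
  **`existsUnique_mem_closedBall_apply_eq`** (every `y ∈ closedBall (Φ δ₀) ρ` has EXACTLY ONE preimage in `closedBall δ₀ r`),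
  **`exists_localInverse_closedBall`** (`Ψ : G → E`, `Ψ (Φ δ₀) = δ₀`, right inverse from the `ρ`-ball into the `r`-ball,
  `(N⁻¹ − c)⁻¹`-Lipschitz there, LEFT inverse on the WHOLE `r`-ball).
* §2 THE MEAN-VALUE SUPPLIER: `approximatesLinearOn_of_norm_fderiv_sub_le` (`‖DΦ(x) − T‖ ≤ c` on a convex set ⟹ the letter; the
  general-`T` twin of the Literature `UniformC1Composition.approximatesLinearOn_id_of_norm_fderiv_sub_id_le`).
* §3 THE BRANCH ALONG A SLICE: **`exists_sliceBranch`** (`Φ : E → F × H`, sup norm: `σ w := Ψ (w, (Φ δ₀).2)` has `σ (Φ δ₀).1 = δ₀`,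
  `σ w ∈ closedBall δ₀ r ∧ (Φ(σ w)).1 = w ∧ (Φ(σ w)).2 = (Φ δ₀).2` on `closedBall (Φ δ₀).1 ρ`, `(N⁻¹ − c)⁻¹`-Lipschitz there, and
  EVERY `δ` of the `r`-ball on the slice is `σ (Φ δ).1`); **`exists_branch_chart`** (`Φ = (D, g)`, `D` continuous linear, `g`
  differentiable with `‖Dg(x) − g′‖ ≤ c` on the ball, `T h = (D h, g′ h)`: the branch of `g = g δ₀` points over
  `closedBall (Dδ₀) ρ`); **`exists_criticalBranch_chart`** — CMR §1's letters made quantitative: `V` twice differentiable on the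
  ball with `‖V″ x − V″ δ₀‖ ≤ c` (the small-field letter), test directions `ι : K →L[ℝ] E` with `‖ι‖ ≤ 1` (instantiate `K := ker D`,
  `ι` the inclusion), `δ₀` critical along `ι`, augmented Hessian `h ↦ (D h, V″(δ₀) h ∘ ι)` = `T` ⟹ the branch of points critical
  along `ι`, `D(σ w) = w`, radius `ρ`, constant `(N⁻¹ − c)⁻¹`, unique among ι-critical points of the whole `r`-ball;
  **`exists_criticalBranch_chart_ker`** — the same with `K := ker D`, `ι` the inclusion: CMR §1's letters VERBATIM
  (`∀ k ∈ D.ker, fderiv ℝ V δ k = 0`), conclusions with radius and constant instead of `∀ᶠ`.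
* §4 toy (`example`): `Φ = id` on `ℝ`, `T = 1`, `N = 1`, `c = 0`.

NOT HERE (honest): higher regularity of `σ` with constants (`C¹` with `‖Dσ‖ ≤ (N⁻¹ − c)⁻¹` is one more Mathlib line —
`ApproximatesLinearOn.toOpenPartialHomeomorph` + `HasFDerivAt.of_local_left_inverse`; CMR ∕ CMRA give the qualitative class);
surjectivity of `D` is NOT assumed (it is inside the letter «`T` is an equivalence»); which `Φ, T, N, c, r` are Bałaban's ((A3) ∕
(A1c), NC-NE7b-α UNRULED) — in print `N` is (71)'s `‖(I + 𝔎R)⁻¹‖`-type constant and `c` the small-field variation of the Hessian;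
anything of Bałaban's.  BY-NAME EFFECT ON THE WALL: NONE.  NE7b NOT PRINTED ∕ NOT PROVED; spine PROVED 0∕9; rung (B)+1 on a FINITE
torus — NOT infinite volume, NOT the mass gap, NOT Clay.  HONEST DEPENDENCY: continuum YM on T⁴ ⇐ BetaPertH ∧ nine spine estimates
(0/9 proved); BetaPertH ⇐ (D1) ∧ (D4) ∧ CAP+tail; G-an2-4 gates asym, D1 and NE2∕3∕4.
-/

set_option autoImplicit false

noncomputable section

namespace Summit.QuantumFields.BalabanUV.T4Continuum.NE7b.HardStepChartRadius

open Set Filter Topology Function Metric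
open scoped NNReal

variable {E G : Type*} [NormedAddCommGroup E] [NormedSpace ℝ E] [NormedAddCommGroup G] [NormedSpace ℝ G]

/-! ## §0. The inverse-norm letter -/

/-- On a nontrivial space the inverse of a linear equivalence has positive operator norm. [folklore] -/
theorem nnnorm_symm_pos [Nontrivial E] (T : E ≃L[ℝ] G) : 0 < ‖(T.symm : G →L[ℝ] E)‖₊ := by
  obtain ⟨v, hv⟩ := exists_ne (0 : E)
  refine pos_iff_ne_zero.2 fun h0 => hv ?_
  have h1 : (T.symm : G →L[ℝ] E) (T v) = v := T.symm_apply_apply v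
  have h2 : (T.symm : G →L[ℝ] E) = 0 := nnnorm_eq_zero.1 h0
  rw [h2] at h1
  exact h1.symm.trans (by simp)

/-- The POINTWISE inverse-norm letter `‖T⁻¹ y‖ ≤ N‖y‖` gives `‖T⁻¹‖ ≤ N`. [folklore] -/
theorem nnnorm_symm_le_of_bound (T : E ≃L[ℝ] G) {N : ℝ≥0} (hN : ∀ y : G, ‖T.symm y‖ ≤ N * ‖y‖) :
    ‖(T.symm : G →L[ℝ] E)‖₊ ≤ N :=
  ContinuousLinearMap.opNNNorm_le_bound _ _ fun y => hN y

/-- `‖T⁻¹ y‖ ≤ N‖y‖` and `c < N⁻¹` give Mathlib's letter `c < ‖T⁻¹‖⁻¹`. [folklore] -/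
theorem lt_inv_nnnorm_symm [Nontrivial E] (T : E ≃L[ℝ] G) {N c : ℝ≥0} (hN : ∀ y : G, ‖T.symm y‖ ≤ N * ‖y‖)
    (hc : c < N⁻¹) : c < ‖(T.symm : G →L[ℝ] E)‖₊⁻¹ :=
  hc.trans_le (inv_anti₀ (nnnorm_symm_pos T) (nnnorm_symm_le_of_bound T hN))

/-- The same in `ℝ`: `N⁻¹ − c ≤ ‖T⁻¹‖⁻¹ − c`, so the `N`-ball sits inside Mathlib's ball. [folklore] -/
theorem inv_sub_le_inv_nnnorm_symm_sub [Nontrivial E] (T : E ≃L[ℝ] G) {N c : ℝ≥0}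
    (hN : ∀ y : G, ‖T.symm y‖ ≤ N * ‖y‖) :
    ((N : ℝ)⁻¹ - c) ≤ ((‖(T.symm : G →L[ℝ] E)‖₊ : ℝ)⁻¹ - c) := by
  have hpos : (0 : ℝ) < ‖(T.symm : G →L[ℝ] E)‖₊ := by exact_mod_cast nnnorm_symm_pos T
  have hN' : ((‖(T.symm : G →L[ℝ] E)‖₊ : ℝ≥0) : ℝ) ≤ N := by exact_mod_cast nnnorm_symm_le_of_bound T hN
  linarith [inv_anti₀ hpos hN']

/-! ## §1. The chart of explicit radius -/

section Chart

variable [CompleteSpace E] [Nontrivial E]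

omit [CompleteSpace E] in
/-- **INVERSE LIPSCHITZ ON THE BALL**: `Φ` approximating `T` on `closedBall δ₀ r` with defect `c`, `‖T⁻¹ y‖ ≤ N‖y‖`,
`c < N⁻¹` ⟹ `‖δ − δ′‖ ≤ (N⁻¹ − c)⁻¹ ‖Φ δ − Φ δ′‖` for `δ, δ′` in the ball. [folklore] -/
theorem norm_sub_le_mul_norm_apply_sub {Φ : E → G} (T : E ≃L[ℝ] G) {δ₀ : E} {r : ℝ} {N c : ℝ≥0}
    (hN : ∀ y : G, ‖T.symm y‖ ≤ N * ‖y‖) (hc : c < N⁻¹)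
    (hΦ : ApproximatesLinearOn Φ (T : E →L[ℝ] G) (closedBall δ₀ r) c)
    {δ δ' : E} (hδ : δ ∈ closedBall δ₀ r) (hδ' : δ' ∈ closedBall δ₀ r) :
    ‖δ - δ'‖ ≤ ((N⁻¹ - c)⁻¹ : ℝ≥0) * ‖Φ δ - Φ δ'‖ := by
  have hc' := lt_inv_nnnorm_symm T hN hc
  have h := (hΦ.antilipschitz (Or.inr hc')).le_mul_dist ⟨δ, hδ⟩ ⟨δ', hδ'⟩
  rw [Subtype.dist_eq, dist_eq_norm, restrict_apply, restrict_apply, dist_eq_norm] at h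
  refine h.trans (mul_le_mul_of_nonneg_right ?_ (norm_nonneg _))
  have h1 : N⁻¹ - c ≤ ‖(T.symm : G →L[ℝ] E)‖₊⁻¹ - c :=
    tsub_le_tsub_right (inv_anti₀ (nnnorm_symm_pos T) (nnnorm_symm_le_of_bound T hN)) c
  have h2 : 0 < N⁻¹ - c := tsub_pos_of_lt hc
  exact_mod_cast inv_anti₀ h2 h1

/-- **EXACTLY ONE PREIMAGE IN THE BALL**: under the same letters and `0 ≤ r`, every
`y ∈ closedBall (Φ δ₀) ((N⁻¹ − c) r)` has exactly one `δ ∈ closedBall δ₀ r` with `Φ δ = y`. [folklore] -/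
theorem existsUnique_mem_closedBall_apply_eq {Φ : E → G} (T : E ≃L[ℝ] G) {δ₀ : E} {r : ℝ} (hr : 0 ≤ r)
    {N c : ℝ≥0} (hN : ∀ y : G, ‖T.symm y‖ ≤ N * ‖y‖) (hc : c < N⁻¹)
    (hΦ : ApproximatesLinearOn Φ (T : E →L[ℝ] G) (closedBall δ₀ r) c)
    {y : G} (hy : y ∈ closedBall (Φ δ₀) (((N : ℝ)⁻¹ - c) * r)) :
    ∃! δ : E, δ ∈ closedBall δ₀ r ∧ Φ δ = y := by
  have hc' := lt_inv_nnnorm_symm T hN hc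
  have hsurj := hΦ.surjOn_closedBall_of_nonlinearRightInverse T.toNonlinearRightInverse hr Subset.rfl
  have hnn : (T.toNonlinearRightInverse.nnnorm : ℝ) = ‖(T.symm : G →L[ℝ] E)‖₊ := rfl
  have hy' : y ∈ closedBall (Φ δ₀) (((T.toNonlinearRightInverse.nnnorm : ℝ)⁻¹ - c) * r) := by
    refine closedBall_subset_closedBall ?_ hy
    rw [hnn]
    exact mul_le_mul_of_nonneg_right (inv_sub_le_inv_nnnorm_symm_sub T hN) hr
  obtain ⟨δ, hδ, hδy⟩ := hsurj hy'
  refine ⟨δ, ⟨hδ, hδy⟩, fun δ' hδ' => ?_⟩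
  exact hΦ.injOn (Or.inr hc') hδ'.1 hδ (hδ'.2.trans hδy.symm)

/-- **THE LOCAL INVERSE ON THE BALL OF EXPLICIT RADIUS**: there is `Ψ : G → E` with `Ψ (Φ δ₀) = δ₀`, mapping
`closedBall (Φ δ₀) ((N⁻¹ − c) r)` into `closedBall δ₀ r` as a right inverse of `Φ`, `(N⁻¹ − c)⁻¹`-Lipschitz there,
and a LEFT inverse of `Φ` on the WHOLE ball `closedBall δ₀ r`. [folklore] -/
theorem exists_localInverse_closedBall {Φ : E → G} (T : E ≃L[ℝ] G) {δ₀ : E} {r : ℝ} (hr : 0 ≤ r)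
    {N c : ℝ≥0} (hN : ∀ y : G, ‖T.symm y‖ ≤ N * ‖y‖) (hc : c < N⁻¹)
    (hΦ : ApproximatesLinearOn Φ (T : E →L[ℝ] G) (closedBall δ₀ r) c) :
    ∃ Ψ : G → E, Ψ (Φ δ₀) = δ₀ ∧
      (∀ y ∈ closedBall (Φ δ₀) (((N : ℝ)⁻¹ - c) * r), Ψ y ∈ closedBall δ₀ r ∧ Φ (Ψ y) = y) ∧
      (∀ δ ∈ closedBall δ₀ r, Ψ (Φ δ) = δ) ∧
      LipschitzOnWith (N⁻¹ - c)⁻¹ Ψ (closedBall (Φ δ₀) (((N : ℝ)⁻¹ - c) * r)) := by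
  have hc' := lt_inv_nnnorm_symm T hN hc
  have hinj : InjOn Φ (closedBall δ₀ r) := hΦ.injOn (Or.inr hc')
  have hleft : ∀ δ ∈ closedBall δ₀ r, invFunOn Φ (closedBall δ₀ r) (Φ δ) = δ :=
    fun δ hδ => hinj.leftInvOn_invFunOn hδ
  have hright : ∀ y ∈ closedBall (Φ δ₀) (((N : ℝ)⁻¹ - c) * r),
      invFunOn Φ (closedBall δ₀ r) y ∈ closedBall δ₀ r ∧ Φ (invFunOn Φ (closedBall δ₀ r) y) = y := by
    intro y hy
    obtain ⟨δ, ⟨hδ, hδy⟩, -⟩ := existsUnique_mem_closedBall_apply_eq T hr hN hc hΦ hy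
    have hex : ∃ a ∈ closedBall δ₀ r, Φ a = y := ⟨δ, hδ, hδy⟩
    exact ⟨invFunOn_mem hex, invFunOn_eq hex⟩
  refine ⟨invFunOn Φ (closedBall δ₀ r), hleft δ₀ (mem_closedBall_self hr), hright, hleft, ?_⟩
  refine LipschitzOnWith.of_dist_le_mul fun y hy y' hy' => ?_
  rw [dist_eq_norm, dist_eq_norm]
  have h := norm_sub_le_mul_norm_apply_sub T hN hc hΦ (hright y hy).1 (hright y' hy').1
  rwa [(hright y hy).2, (hright y' hy').2] at h

end Chart

/-! ## §2. The mean-value supplier -/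

/-- **A DERIVATIVE `c`-CLOSE TO `T` ON A CONVEX SET GIVES THE APPROXIMATION LETTER** (mean value inequality):
`‖DΦ(x) − T‖ ≤ c` for `x ∈ s` convex ⟹ `ApproximatesLinearOn Φ T s c`. [folklore] -/
theorem approximatesLinearOn_of_norm_fderiv_sub_le {Φ : E → G} (T : E →L[ℝ] G) {s : Set E} (hs : Convex ℝ s)
    (hd : ∀ x ∈ s, DifferentiableAt ℝ Φ x) {c : ℝ≥0} (hc : ∀ x ∈ s, ‖fderiv ℝ Φ x - T‖ ≤ c) :
    ApproximatesLinearOn Φ T s c := fun _ hx _ hy =>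
  hs.norm_image_sub_le_of_norm_fderiv_le' hd hc hy hx

/-! ## §3. The branch along a slice: the hard step's background field with radius and constant -/

section Branch

variable {F H : Type*} [NormedAddCommGroup F] [NormedSpace ℝ F] [NormedAddCommGroup H] [NormedSpace ℝ H]
variable [CompleteSpace E] [Nontrivial E]

/-- **THE BRANCH ALONG A SLICE OF A CHART**: `Φ : E → F × H` (sup norm) approximating `T` on `closedBall δ₀ r`,
`‖T⁻¹ y‖ ≤ N‖y‖`, `c < N⁻¹`, `z₀ := (Φ δ₀).2` ⟹ there is `σ : F → E` with `σ (Φ δ₀).1 = δ₀`; for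
`w ∈ closedBall (Φ δ₀).1 ((N⁻¹ − c) r)`: `σ w ∈ closedBall δ₀ r`, `(Φ (σ w)).1 = w`, `(Φ (σ w)).2 = z₀`; `σ` is
`(N⁻¹ − c)⁻¹`-Lipschitz there; and EVERY `δ ∈ closedBall δ₀ r` on the slice `(Φ δ).2 = z₀` is `σ (Φ δ).1`. [folklore] -/
theorem exists_sliceBranch {Φ : E → F × H} (T : E ≃L[ℝ] F × H) {δ₀ : E} {r : ℝ} (hr : 0 ≤ r)
    {N c : ℝ≥0} (hN : ∀ y : F × H, ‖T.symm y‖ ≤ N * ‖y‖) (hc : c < N⁻¹)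
    (hΦ : ApproximatesLinearOn Φ (T : E →L[ℝ] F × H) (closedBall δ₀ r) c) :
    ∃ σ : F → E, σ (Φ δ₀).1 = δ₀ ∧
      (∀ w ∈ closedBall (Φ δ₀).1 (((N : ℝ)⁻¹ - c) * r),
        σ w ∈ closedBall δ₀ r ∧ (Φ (σ w)).1 = w ∧ (Φ (σ w)).2 = (Φ δ₀).2) ∧
      LipschitzOnWith (N⁻¹ - c)⁻¹ σ (closedBall (Φ δ₀).1 (((N : ℝ)⁻¹ - c) * r)) ∧
      (∀ δ ∈ closedBall δ₀ r, (Φ δ).2 = (Φ δ₀).2 → σ (Φ δ).1 = δ) := by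
  obtain ⟨Ψ, hΨ0, hright, hleft, hlip⟩ := exists_localInverse_closedBall T hr hN hc hΦ
  have hslice : ∀ w ∈ closedBall (Φ δ₀).1 (((N : ℝ)⁻¹ - c) * r),
      (w, (Φ δ₀).2) ∈ closedBall (Φ δ₀) (((N : ℝ)⁻¹ - c) * r) := by
    intro w hw
    rw [mem_closedBall, Prod.dist_eq, dist_self, max_eq_left dist_nonneg]
    exact hw
  refine ⟨fun w => Ψ (w, (Φ δ₀).2), ?_, ?_, ?_, ?_⟩
  · show Ψ ((Φ δ₀).1, (Φ δ₀).2) = δ₀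
    rw [Prod.mk.eta, hΨ0]
  · intro w hw
    obtain ⟨h1, h2⟩ := hright _ (hslice w hw)
    have h3 := Prod.ext_iff.1 h2
    exact ⟨h1, by simpa using h3.1, by simpa using h3.2⟩
  · refine LipschitzOnWith.of_dist_le_mul fun w hw w' hw' => ?_
    have h := hlip.dist_le_mul _ (hslice w hw) _ (hslice w' hw')
    refine h.trans (le_of_eq ?_)
    rw [Prod.dist_eq, dist_self, max_eq_left dist_nonneg]
  · intro δ hδ hz
    show Ψ ((Φ δ).1, (Φ δ₀).2) = δ
    rw [← hz, Prod.mk.eta, hleft δ hδ]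

/-- **THE BRANCH OF `g = const` POINTS OVER THE KEPT VARIABLE, WITH RADIUS AND CONSTANT**: `D : E →L[ℝ] F` the kept
(averaging) map, `g : E → H` the transversal map, `T : E ≃L[ℝ] F × H` the linearisation `T h = (D h, g′ h)` with
`‖T⁻¹ y‖ ≤ N‖y‖`, and `‖Dg(x) − g′‖ ≤ c < N⁻¹` on `closedBall δ₀ r` ⟹ a branch `σ : F → E`, `σ (Dδ₀) = δ₀`, with
`D(σ w) = w`, `g(σ w) = g δ₀`, `σ w ∈ closedBall δ₀ r` for EVERY `w ∈ closedBall (Dδ₀) ((N⁻¹ − c) r)`, `(N⁻¹ − c)⁻¹`-Lipschitz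
there, and unique: every `δ ∈ closedBall δ₀ r` with `g δ = g δ₀` is `σ (Dδ)`. [folklore] -/
theorem exists_branch_chart (D : E →L[ℝ] F) {g : E → H} (g' : E →L[ℝ] H) (T : E ≃L[ℝ] F × H)
    (hT : ∀ h, T h = (D h, g' h)) {δ₀ : E} {r : ℝ} (hr : 0 ≤ r) {N c : ℝ≥0}
    (hN : ∀ y : F × H, ‖T.symm y‖ ≤ N * ‖y‖) (hc : c < N⁻¹)
    (hg : ∀ x ∈ closedBall δ₀ r, DifferentiableAt ℝ g x) (hgc : ∀ x ∈ closedBall δ₀ r, ‖fderiv ℝ g x - g'‖ ≤ c) :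
    ∃ σ : F → E, σ (D δ₀) = δ₀ ∧
      (∀ w ∈ closedBall (D δ₀) (((N : ℝ)⁻¹ - c) * r), σ w ∈ closedBall δ₀ r ∧ D (σ w) = w ∧ g (σ w) = g δ₀) ∧
      LipschitzOnWith (N⁻¹ - c)⁻¹ σ (closedBall (D δ₀) (((N : ℝ)⁻¹ - c) * r)) ∧
      (∀ δ ∈ closedBall δ₀ r, g δ = g δ₀ → σ (D δ) = δ) := by
  set Φ : E → F × H := fun δ => (D δ, g δ)
  have hTe : (T : E →L[ℝ] F × H) = D.prod g' := by
    ext h <;> simp [hT h]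
  have hd : ∀ x ∈ closedBall δ₀ r, DifferentiableAt ℝ Φ x := fun x hx =>
    D.differentiableAt.prodMk (hg x hx)
  have hderiv : ∀ x ∈ closedBall δ₀ r, fderiv ℝ Φ x = D.prod (fderiv ℝ g x) := fun x hx =>
    (D.hasFDerivAt.prodMk (hg x hx).hasFDerivAt).fderiv
  have happ : ApproximatesLinearOn Φ (T : E →L[ℝ] F × H) (closedBall δ₀ r) c := by
    refine approximatesLinearOn_of_norm_fderiv_sub_le _ (convex_closedBall δ₀ r) hd fun x hx => ?_
    rw [hderiv x hx, hTe]
    have h1 : D.prod (fderiv ℝ g x) - D.prod g' = (0 : E →L[ℝ] F).prod (fderiv ℝ g x - g') := by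
      ext h <;> simp
    rw [h1, ContinuousLinearMap.opNorm_prod, Prod.norm_def, norm_zero, max_eq_right (norm_nonneg _)]
    exact hgc x hx
  obtain ⟨σ, hσ0, hσ, hlip, huniq⟩ := exists_sliceBranch T hr hN hc happ
  exact ⟨σ, hσ0, hσ, hlip, fun δ hδ hz => huniq δ hδ hz⟩

/-- **CONSTRAINED CRITICAL POINTS — THE QUANTITATIVE TWIN OF `ConstrainedMinimiserRegular.exists_contDiffAt_criticalBranch`**
in that file's letters.  `D : E →L[ℝ] F` the constraint map; test directions `ι : K →L[ℝ] E` with `‖ι‖ ≤ 1` (instantiate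
`K := ker D` with `ι` the inclusion `Submodule.subtypeL`, `‖ι‖ ≤ 1`); `V : E → ℝ` twice differentiable on `closedBall δ₀ r` with
second derivative `V″` (`HasFDerivAt (fderiv ℝ V) (V″ x) x`) and `‖V″ x − V″ δ₀‖ ≤ c` there (the small-field letter); `δ₀`
critical along `ι` (`DV(δ₀)(ι k) = 0`); the augmented Hessian `h ↦ (D h, V″(δ₀) h ∘ ι)` an equivalence `T` with `‖T⁻¹ y‖ ≤ N‖y‖`;
`c < N⁻¹` ⟹ a branch `σ : F → E` of ι-CRITICAL points, `σ (Dδ₀) = δ₀`, with `D(σ w) = w`, `DV(σ w)(ι k) = 0`,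
`σ w ∈ closedBall δ₀ r` for EVERY `w ∈ closedBall (Dδ₀) ((N⁻¹ − c) r)`, `(N⁻¹ − c)⁻¹`-Lipschitz there, and unique among the
ι-critical points of the WHOLE `r`-ball.  No finite dimension, no convexity, no surjectivity letter, no `∀ᶠ`. [folklore] -/
theorem exists_criticalBranch_chart {K : Type*} [NormedAddCommGroup K] [NormedSpace ℝ K] (ι : K →L[ℝ] E) (hι : ‖ι‖ ≤ 1)
    (D : E →L[ℝ] F) {V : E → ℝ} {V'' : E → E →L[ℝ] E →L[ℝ] ℝ} {δ₀ : E}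
    (T : E ≃L[ℝ] F × (K →L[ℝ] ℝ)) (hT : ∀ h, T h = (D h, (V'' δ₀ h).comp ι))
    {r : ℝ} (hr : 0 ≤ r) {N c : ℝ≥0} (hN : ∀ y : F × (K →L[ℝ] ℝ), ‖T.symm y‖ ≤ N * ‖y‖) (hc : c < N⁻¹)
    (hV : ∀ x ∈ closedBall δ₀ r, HasFDerivAt (fderiv ℝ V) (V'' x) x)
    (hVc : ∀ x ∈ closedBall δ₀ r, ‖V'' x - V'' δ₀‖ ≤ c) (hcrit : ∀ k : K, fderiv ℝ V δ₀ (ι k) = 0) :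
    ∃ σ : F → E, σ (D δ₀) = δ₀ ∧
      (∀ w ∈ closedBall (D δ₀) (((N : ℝ)⁻¹ - c) * r),
        σ w ∈ closedBall δ₀ r ∧ D (σ w) = w ∧ ∀ k : K, fderiv ℝ V (σ w) (ι k) = 0) ∧
      LipschitzOnWith (N⁻¹ - c)⁻¹ σ (closedBall (D δ₀) (((N : ℝ)⁻¹ - c) * r)) ∧
      (∀ δ ∈ closedBall δ₀ r, (∀ k : K, fderiv ℝ V δ (ι k) = 0) → σ (D δ) = δ) := by
  -- the transversal map `g δ = DV(δ) ∘ ι = R (DV δ)` with `R L = L ∘ ι`, `‖R‖ ≤ ‖ι‖ ≤ 1`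
  set R : (E →L[ℝ] ℝ) →L[ℝ] (K →L[ℝ] ℝ) := (ContinuousLinearMap.compL ℝ K E ℝ).flip ι with hR
  have hRapply : ∀ L : E →L[ℝ] ℝ, R L = L.comp ι := fun L => rfl
  have hRnorm : ‖R‖ ≤ 1 := by
    refine ContinuousLinearMap.opNorm_le_bound _ zero_le_one fun L => ?_
    rw [hRapply, one_mul]
    exact (L.opNorm_comp_le ι).trans (mul_le_of_le_one_right (norm_nonneg _) hι)
  set g : E → (K →L[ℝ] ℝ) := fun δ => R (fderiv ℝ V δ) with hg
  -- `g δ = 0` exactly at the ι-critical points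
  have hg0 : ∀ δ : E, g δ = 0 ↔ ∀ k : K, fderiv ℝ V δ (ι k) = 0 := by
    intro δ
    constructor
    · intro h k
      have h3 := congrArg (fun L : K →L[ℝ] ℝ => L k) h
      simpa [hg, hRapply] using h3
    · intro h
      ext k
      simpa [hg, hRapply] using h k
  have hgδ₀ : g δ₀ = 0 := (hg0 δ₀).2 hcrit
  -- the derivative letter for `g`
  have hgd : ∀ x ∈ closedBall δ₀ r, HasFDerivAt g (R.comp (V'' x)) x := fun x hx =>
    R.hasFDerivAt.comp x (hV x hx)
  have hT' : ∀ h, T h = (D h, (R.comp (V'' δ₀)) h) := fun h => by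
    rw [hT h, ContinuousLinearMap.comp_apply, hRapply]
  have hgc : ∀ x ∈ closedBall δ₀ r, ‖fderiv ℝ g x - R.comp (V'' δ₀)‖ ≤ c := fun x hx => by
    rw [(hgd x hx).fderiv, ← ContinuousLinearMap.comp_sub]
    refine (ContinuousLinearMap.opNorm_comp_le _ _).trans ?_
    calc ‖R‖ * ‖V'' x - V'' δ₀‖ ≤ 1 * c :=
          mul_le_mul hRnorm (hVc x hx) (norm_nonneg (V'' x - V'' δ₀)) zero_le_one
      _ = c := one_mul _
  obtain ⟨σ, hσ0, hσ, hlip, huniq⟩ := exists_branch_chart D (R.comp (V'' δ₀)) T hT' hr hN hc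
    (fun x hx => (hgd x hx).differentiableAt) hgc
  refine ⟨σ, hσ0, fun w hw => ?_, hlip, fun δ hδ hδc => huniq δ hδ ?_⟩
  · obtain ⟨h1, h2, h3⟩ := hσ w hw
    refine ⟨h1, h2, (hg0 _).1 ?_⟩
    rw [h3, hgδ₀]
  · rw [(hg0 δ).2 hδc, hgδ₀]

/-- **THE SAME WITH `K := ker D`** (CMR §1's letters verbatim, quantitative): `V` twice differentiable on `closedBall δ₀ r` with
`‖V″ x − V″ δ₀‖ ≤ c`, `δ₀` fibre-critical (`DV(δ₀)` kills `ker D`), the augmented Hessian `h ↦ (D h, V″(δ₀) h |_{ker D})` an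
equivalence `T` with `‖T⁻¹ y‖ ≤ N‖y‖`, `c < N⁻¹` ⟹ the branch `σ` of FIBRE-CRITICAL points: `σ (Dδ₀) = δ₀`; for every
`w ∈ closedBall (Dδ₀) ((N⁻¹ − c) r)`: `σ w ∈ closedBall δ₀ r`, `D(σ w) = w`, `DV(σ w)` kills `ker D`; `(N⁻¹ − c)⁻¹`-Lipschitz there;
every fibre-critical `δ` of the whole `r`-ball is `σ (Dδ)`. [folklore] -/
theorem exists_criticalBranch_chart_ker (D : E →L[ℝ] F) {V : E → ℝ} {V'' : E → E →L[ℝ] E →L[ℝ] ℝ} {δ₀ : E}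
    (T : E ≃L[ℝ] F × (D.ker →L[ℝ] ℝ)) (hT : ∀ h, T h = (D h, (V'' δ₀ h).comp D.ker.subtypeL))
    {r : ℝ} (hr : 0 ≤ r) {N c : ℝ≥0} (hN : ∀ y : F × (D.ker →L[ℝ] ℝ), ‖T.symm y‖ ≤ N * ‖y‖) (hc : c < N⁻¹)
    (hV : ∀ x ∈ closedBall δ₀ r, HasFDerivAt (fderiv ℝ V) (V'' x) x)
    (hVc : ∀ x ∈ closedBall δ₀ r, ‖V'' x - V'' δ₀‖ ≤ c) (hcrit : ∀ k ∈ D.ker, fderiv ℝ V δ₀ k = 0) :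
    ∃ σ : F → E, σ (D δ₀) = δ₀ ∧
      (∀ w ∈ closedBall (D δ₀) (((N : ℝ)⁻¹ - c) * r),
        σ w ∈ closedBall δ₀ r ∧ D (σ w) = w ∧ ∀ k ∈ D.ker, fderiv ℝ V (σ w) k = 0) ∧
      LipschitzOnWith (N⁻¹ - c)⁻¹ σ (closedBall (D δ₀) (((N : ℝ)⁻¹ - c) * r)) ∧
      (∀ δ ∈ closedBall δ₀ r, (∀ k ∈ D.ker, fderiv ℝ V δ k = 0) → σ (D δ) = δ) := by
  obtain ⟨σ, hσ0, hσ, hlip, huniq⟩ := exists_criticalBranch_chart D.ker.subtypeL (Submodule.norm_subtypeL_le _)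
    D T hT hr hN hc hV hVc (fun k => hcrit k k.2)
  refine ⟨σ, hσ0, fun w hw => ?_, hlip, fun δ hδ hδc => huniq δ hδ fun k => hδc k k.2⟩
  obtain ⟨h1, h2, h3⟩ := hσ w hw
  exact ⟨h1, h2, fun k hk => h3 ⟨k, hk⟩⟩

end Branch

/-! ## §4. Toy -/

/-- Toy: `Φ = id` on `ℝ`, `T = 1`, `N = 1`, `c = 0`: every `y ∈ closedBall x r` has exactly one preimage in
`closedBall x r` (itself). [folklore] -/
example (x : ℝ) {r : ℝ} (hr : 0 ≤ r) {y : ℝ}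
    (hy : y ∈ closedBall (id x) ((((1 : ℝ≥0) : ℝ)⁻¹ - ((0 : ℝ≥0) : ℝ)) * r)) :
    ∃! δ : ℝ, δ ∈ closedBall x r ∧ id δ = y := by
  refine existsUnique_mem_closedBall_apply_eq (ContinuousLinearEquiv.refl ℝ ℝ) hr (N := 1) (c := 0) ?_
    (by norm_num) ?_ hy
  · intro z
    simp
  · intro a _ b _
    simp

end Summit.QuantumFields.BalabanUV.T4Continuum.NE7b.HardStepChartRadius

end
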